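import Mathlib

/-!
# The open subgroups `∏_v U_v` are a neighbourhood basis of `1` in a restricted product

Blind cell `pub-hodge-repro2`, seat p8 (gen 8), Tier-4 B5 kernel support.  Remark B5.9 of
route/T4-B5-p8.md (GAPS (R5)) uses, without a typed locator, «that the open subgroups `∏_v U_v` of
`(A_E^∞)^1` form a neighbourhood basis at `1` (the definition of the restricted-product topology)».
This file records that fact from Mathlib's `RestrictedProduct` (`Πʳ i, [R i, B i]`, the restricted
product of topological groups `R i` with respect to open subgroups `B i`, cofinite filter):

* `piSet U := {x | ∀ i, x i ∈ U i}` for a family of subgroups `U i ≤ B i` with `U i = B i` for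
  almost all `i`; it is a subgroup (`piSubgroup`) and OPEN (`isOpen_piSet`: the image under the
  open embedding `structureMap` of a basic open box of `∏ B i`);
* `exists_piSet_subset_of_mem_nhds` — every neighbourhood of `1` contains such a `piSet U`, PROVIDED
  each `B i` has a neighbourhood basis of open subgroups of `R i` (true for the maximal compact
  subgroups of `p`-adic groups — van Dantzig — and for the `O_{E_v}^1`; stated as the hypothesis
  `hbasis`);
* `hasBasis_piSet` — the `piSet U` form a `Filter.HasBasis` of `𝓝 1`.

Nothing in this file touches the frozen text of T4-B5-p8.md v9.

README §8(d): uses an L-value-free non-vanishing device: NO.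
-/

namespace Summit.Ventures.HodgeRepro2.LevelRestrictedProductBasis

open RestrictedProduct Filter Topology Set
open scoped RestrictedProduct

variable {ι : Type*} {R : ι → Type*} [Π i, Group (R i)] {B : Π i, Subgroup (R i)}

section Algebraic

/-- The subset `∏_i U_i` of the restricted product `Πʳ i, [R i, B i]`. -/
def piSet (U : Π i, Subgroup (R i)) : Set (Πʳ i, [R i, B i]) := {x | ∀ i, x i ∈ U i}

/-- Membership in `piSet`. -/
theorem mem_piSet_iff {U : Π i, Subgroup (R i)} {x : Πʳ i, [R i, B i]} :
    x ∈ piSet (B := B) U ↔ ∀ i, x i ∈ U i := Iff.rfl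

/-- `∏_i U_i` is a subgroup of the restricted product. -/
def piSubgroup (U : Π i, Subgroup (R i)) : Subgroup (Πʳ i, [R i, B i]) where
  carrier := piSet U
  one_mem' i := by
    rw [one_apply]
    exact (U i).one_mem
  mul_mem' {x y} hx hy i := by
    rw [mul_apply]
    exact (U i).mul_mem (hx i) (hy i)
  inv_mem' {x} hx i := by
    rw [inv_apply]
    exact (U i).inv_mem (hx i)

/-- The carrier of `piSubgroup U` is `piSet U`. -/
theorem coe_piSubgroup (U : Π i, Subgroup (R i)) :
    (piSubgroup (B := B) U : Set (Πʳ i, [R i, B i])) = piSet U := rfl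

/-- `piSet U` is the image under the structure map of the box `∏_i (U_i ∩ B_i)` of `∏_i B_i`. -/
theorem piSet_eq_image (U : Π i, Subgroup (R i)) (hle : ∀ i, U i ≤ B i) :
    piSet (B := B) U = structureMap R (fun i => (B i : Set (R i))) cofinite ''
      {y : Π i, (B i : Set (R i)) | ∀ i, (y i : R i) ∈ U i} := by
  ext x
  constructor
  · intro hx
    obtain ⟨y, rfl⟩ := exists_structureMap_eq_of_forall R _ (fun i => hle i (hx i))
    exact ⟨y, fun i => hx i, rfl⟩
  · rintro ⟨y, hy, rfl⟩
    intro i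
    exact hy i

/-- `1 ∈ piSet U`. -/
theorem one_mem_piSet (U : Π i, Subgroup (R i)) : (1 : Πʳ i, [R i, B i]) ∈ piSet (B := B) U :=
  (piSubgroup U).one_mem

end Algebraic

section Topological

variable [Π i, TopologicalSpace (R i)]

/-- `piSet U` is open when the `U i ≤ B i` are open and `U i = B i` for almost all `i`. -/
theorem isOpen_piSet (hBopen : ∀ i, IsOpen (B i : Set (R i))) (U : Π i, Subgroup (R i))
    (hU : ∀ i, IsOpen (U i : Set (R i))) (hle : ∀ i, U i ≤ B i)
    (hcof : ∀ᶠ i in cofinite, U i = B i) : IsOpen (piSet (B := B) U) := by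
  rw [piSet_eq_image U hle]
  refine (isOpenEmbedding_structureMap hBopen).isOpenMap _ ?_
  have hI : {i | U i ≠ B i}.Finite := by simpa [Filter.eventually_cofinite] using hcof
  have hbox : {y : Π i, (B i : Set (R i)) | ∀ i, (y i : R i) ∈ U i} =
      {i | U i ≠ B i}.pi (fun i => Subtype.val ⁻¹' (U i : Set (R i))) := by
    ext y
    simp only [mem_setOf_eq, Set.mem_pi]
    constructor
    · intro h i _
      exact h i
    · intro h i
      by_cases hi : U i = B i
      · rw [hi]
        exact (y i).2
      · exact h i hi
  rw [hbox]
  exact isOpen_set_pi hI fun i _ => (hU i).preimage continuous_subtype_val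


/-- EVERY NEIGHBOURHOOD OF `1` IN THE RESTRICTED PRODUCT CONTAINS AN OPEN SUBGROUP `∏_i U_i` with
`U i ≤ B i` open and `U i = B i` for almost all `i`, provided each `B i` has a neighbourhood basis of
open subgroups of `R i` (the hypothesis `hbasis`). -/
theorem exists_piSet_subset_of_mem_nhds (hBopen : ∀ i, IsOpen (B i : Set (R i)))
    (hbasis : ∀ i, ∀ N ∈ 𝓝 (1 : R i),
      ∃ U : Subgroup (R i), IsOpen (U : Set (R i)) ∧ U ≤ B i ∧ (U : Set (R i)) ⊆ N)
    {N : Set (Πʳ i, [R i, B i])} (hN : N ∈ 𝓝 1) :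
    ∃ U : Π i, Subgroup (R i), (∀ i, IsOpen (U i : Set (R i))) ∧ (∀ i, U i ≤ B i) ∧
      (∀ᶠ i in cofinite, U i = B i) ∧ piSet (B := B) U ⊆ N := by
  set x₁ : Π i, (B i : Set (R i)) := fun i => ⟨1, (B i).one_mem⟩ with hx₁
  have h1 : (1 : Πʳ i, [R i, B i]) = structureMap R (fun i => (B i : Set (R i))) cofinite x₁ :=
    RestrictedProduct.ext R _ fun _ => rfl
  rw [h1, nhds_eq_map_structureMap hBopen, mem_map, nhds_pi, Filter.mem_pi] at hN
  obtain ⟨I, hI, t, ht, hsub⟩ := hN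
  have hchoice : ∀ i, ∃ U : Subgroup (R i), IsOpen (U : Set (R i)) ∧ U ≤ B i ∧
      (i ∉ I → U = B i) ∧ (i ∈ I → ∀ b : (B i : Set (R i)), (b : R i) ∈ U → b ∈ t i) := by
    intro i
    by_cases hi : i ∈ I
    · obtain ⟨N', hN', hN't⟩ := (mem_nhds_subtype _ _ _).mp (ht i)
      obtain ⟨U, hUo, hUB, hUN⟩ := hbasis i N' hN'
      exact ⟨U, hUo, hUB, fun h => absurd hi h, fun _ b hb => hN't (hUN hb)⟩
    · exact ⟨B i, hBopen i, le_rfl, fun _ => rfl, fun h => absurd h hi⟩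
  choose U hUo hUB hUeq hUt using hchoice
  refine ⟨U, hUo, hUB, ?_, ?_⟩
  · exact hI.subset fun i hi => by
      by_contra h
      exact hi (hUeq i h)
  · intro x hx
    obtain ⟨y, rfl⟩ := exists_structureMap_eq_of_forall R _ (fun i => hUB i (hx i))
    apply hsub
    intro i hi
    exact hUt i hi (y i) (hx i)

/-- THE OPEN SUBGROUPS `∏_i U_i` FORM A NEIGHBOURHOOD BASIS OF `1` in the restricted product
(`Filter.HasBasis` form), under the hypothesis `hbasis` on the factors. -/
theorem hasBasis_piSet (hBopen : ∀ i, IsOpen (B i : Set (R i)))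
    (hbasis : ∀ i, ∀ N ∈ 𝓝 (1 : R i),
      ∃ U : Subgroup (R i), IsOpen (U : Set (R i)) ∧ U ≤ B i ∧ (U : Set (R i)) ⊆ N) :
    (𝓝 (1 : Πʳ i, [R i, B i])).HasBasis
      (fun U : Π i, Subgroup (R i) =>
        (∀ i, IsOpen (U i : Set (R i))) ∧ (∀ i, U i ≤ B i) ∧ (∀ᶠ i in cofinite, U i = B i))
      (fun U => piSet (B := B) U) := by
  refine ⟨fun N => ⟨fun hN => ?_, ?_⟩⟩
  · obtain ⟨U, hUo, hUB, hcof, hsub⟩ := exists_piSet_subset_of_mem_nhds hBopen hbasis hN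
    exact ⟨U, ⟨hUo, hUB, hcof⟩, hsub⟩
  · rintro ⟨U, ⟨hUo, hUB, hcof⟩, hsub⟩
    exact mem_of_superset ((isOpen_piSet hBopen U hUo hUB hcof).mem_nhds (one_mem_piSet U)) hsub

end Topological

end Summit.Ventures.HodgeRepro2.LevelRestrictedProductBasis
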